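import Mathlib.MeasureTheory.MeasurableSpace.Prod
import Mathlib.MeasureTheory.Measure.Restrict
import HarnessLib

/-!
# Two measures on a product agreeing on rectangles over π-systems are equal

Topic `MeasureTheory/Measure`; namespace `Literature.MeasureTheory.Measure`.  THEOREMS ONLY (no definition, no instance, no
notation, no named fact, no `sorry`); Mathlib-only imports.  The rectangle form of the uniqueness theorem for σ-finite measures
([Halmos1950] §13 Thm A «a σ-finite measure on a ring has a unique extension»; [Folland1999] Thm 1.14; Mathlib
`MeasureTheory.Measure.ext_of_generateFrom_of_iUnion` on the π-system of rectangles, `generateFrom_prod_eq`, `IsPiSystem.prod`):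

* **`ext_of_prod_rectangles`** — `μ, ν : Measure (X × Y)`; `C ⊆ 𝒫(X)`, `𝓑 ⊆ 𝒫(Y)` π-systems generating the σ-algebras; countable covers
  `A i ∈ C`, `B j ∈ 𝓑` with `μ (A i ×ˢ B j) ≠ ∞`; `μ (A ×ˢ B) = ν (A ×ˢ B)` for `A ∈ C`, `B ∈ 𝓑`  ⇒  `μ = ν`;
* `ext_of_measurable_prod_rectangles` — the case `C = {A | MeasurableSet A}` (rectangles with an arbitrary Borel first factor);
* `eq_smul_of_prod_rectangles` — the same with a scalar: `μ (A ×ˢ B) = κ * ν (A ×ˢ B)` on rectangles ⇒ `μ = κ • ν`.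

Cell `hodgecm-mathlib`, H413 E-2 SW2 identity road, step (RECT) of the pen's I-CLOSE sheet (`F0/P4/F0P2a-p08/SW2-ICLOSE-ASSEMBLY.v0`
§1 (RECT), §2 (4)): combined with ★ `Theorems/H413E2SWIdentityCloseCore.prod_eq_smul_prod_of_dilate_bound` (per-rectangle
`μ̂(A ×ˢ B) = κ₀ · μ′(A ×ˢ B)`) it yields `μ̂ = κ₀ • μ′`.  HC_CM is proved only modulo the 7 printed citations until rung 0 closes —
nothing here bears on a summit statement.

## References
* [Halmos1950] P. R. Halmos, *Measure Theory* (1950), §13 Theorem A (uniqueness of the extension of a σ-finite measure).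
* [Folland1999] G. B. Folland, *Real Analysis*, 2nd ed. (1999), Thm 1.14 (uniqueness on a generating π-system / algebra).
-/

set_option autoImplicit false

noncomputable section

open MeasureTheory MeasurableSpace Set
open scoped ENNReal NNReal

namespace Literature.MeasureTheory.Measure

variable {X Y : Type*} [MeasurableSpace X] [MeasurableSpace Y]

/-- **Uniqueness from rectangles over π-systems.**  Let `C`, `𝓑` be π-systems generating the σ-algebras of `X`, `Y`, with countable
covers `A : ℕ → Set X`, `B : ℕ → Set Y` by members of `C`, `𝓑`; let `μ ν : Measure (X × Y)` with `μ (A i ×ˢ B j) ≠ ∞` for all `i j`,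
agreeing on all rectangles `S ×ˢ T`, `S ∈ C`, `T ∈ 𝓑`.  Then `μ = ν` (the rectangles form a π-system generating the product
σ-algebra, covered by the countably many finite-measure rectangles `A i ×ˢ B j`).
[cite: Halmos1950, §13 Theorem A] [cite: Folland1999, Thm 1.14] -/
theorem ext_of_prod_rectangles {μ ν : Measure (X × Y)} {C : Set (Set X)} {𝓑 : Set (Set Y)}
    (hC : ‹MeasurableSpace X› = generateFrom C) (h𝓑 : ‹MeasurableSpace Y› = generateFrom 𝓑)
    (hCpi : IsPiSystem C) (h𝓑pi : IsPiSystem 𝓑)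
    (A : ℕ → Set X) (hA : ∀ i, A i ∈ C) (hAcov : ⋃ i, A i = univ)
    (B : ℕ → Set Y) (hB : ∀ j, B j ∈ 𝓑) (hBcov : ⋃ j, B j = univ)
    (hfin : ∀ i j, μ (A i ×ˢ B j) ≠ ∞)
    (h_eq : ∀ S ∈ C, ∀ T ∈ 𝓑, μ (S ×ˢ T) = ν (S ×ˢ T)) : μ = ν := by
  have hCsp : IsCountablySpanning C := ⟨A, hA, hAcov⟩
  have h𝓑sp : IsCountablySpanning 𝓑 := ⟨B, hB, hBcov⟩
  -- the rectangles generate the product σ-algebra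
  have hgen : (inferInstance : MeasurableSpace (X × Y)) = generateFrom (image2 (· ×ˢ ·) C 𝓑) := by
    have h := generateFrom_eq_prod (α := X) (β := Y) (C := C) (D := 𝓑) hC.symm h𝓑.symm hCsp h𝓑sp
    exact h.symm
  -- the countable cover by finite-measure rectangles, indexed by `ℕ` through `Nat.unpair`
  refine Measure.ext_of_generateFrom_of_iUnion (image2 (· ×ˢ ·) C 𝓑)
    (fun n => A (Nat.unpair n).1 ×ˢ B (Nat.unpair n).2) hgen (hCpi.prod h𝓑pi) ?_ (fun n => mem_image2_of_mem (hA _) (hB _))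
    (fun n => hfin _ _) ?_
  · -- the rectangles `A i ×ˢ B j` cover `X × Y`
    apply eq_univ_of_forall
    rintro ⟨x, y⟩
    have hx : x ∈ ⋃ i, A i := by rw [hAcov]; trivial
    have hy : y ∈ ⋃ j, B j := by rw [hBcov]; trivial
    obtain ⟨i, hi⟩ := mem_iUnion.1 hx
    obtain ⟨j, hj⟩ := mem_iUnion.1 hy
    refine mem_iUnion.2 ⟨Nat.pair i j, ?_⟩
    rw [Nat.unpair_pair]
    exact ⟨hi, hj⟩
  · rintro _ ⟨S, hS, T, hT, rfl⟩
    exact h_eq S hS T hT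

/-- **Rectangles with an arbitrary measurable first factor**: if `𝓑` is a π-system generating the σ-algebra of `Y` with a countable cover
`B j`, `X` is covered by countably many measurable `A i` with `μ (A i ×ˢ B j) ≠ ∞`, and `μ (S ×ˢ T) = ν (S ×ˢ T)` for every measurable
`S` and every `T ∈ 𝓑`, then `μ = ν`. [cite: Halmos1950, §13 Theorem A] [cite: Folland1999, Thm 1.14] -/
theorem ext_of_measurable_prod_rectangles {μ ν : Measure (X × Y)} {𝓑 : Set (Set Y)}
    (h𝓑 : ‹MeasurableSpace Y› = generateFrom 𝓑) (h𝓑pi : IsPiSystem 𝓑)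
    (A : ℕ → Set X) (hA : ∀ i, MeasurableSet (A i)) (hAcov : ⋃ i, A i = univ)
    (B : ℕ → Set Y) (hB : ∀ j, B j ∈ 𝓑) (hBcov : ⋃ j, B j = univ)
    (hfin : ∀ i j, μ (A i ×ˢ B j) ≠ ∞)
    (h_eq : ∀ S : Set X, MeasurableSet S → ∀ T ∈ 𝓑, μ (S ×ˢ T) = ν (S ×ˢ T)) : μ = ν :=
  ext_of_prod_rectangles (C := {S : Set X | MeasurableSet S}) (generateFrom_measurableSet (α := X)).symm h𝓑
    (fun _ hS _ hT _ => hS.inter hT) h𝓑pi A hA hAcov B hB hBcov hfin (fun S hS T hT => h_eq S hS T hT)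

/-- **Scalar form**: under the same hypotheses, `μ (S ×ˢ T) = κ * ν (S ×ˢ T)` on rectangles (measurable `S`, `T ∈ 𝓑`) with
`ν (A i ×ˢ B j) ≠ ∞` gives `μ = κ • ν` (`κ : ℝ≥0`). [cite: Halmos1950, §13 Theorem A] [cite: Folland1999, Thm 1.14] -/
theorem eq_smul_of_prod_rectangles {μ ν : Measure (X × Y)} (κ : ℝ≥0) {𝓑 : Set (Set Y)}
    (h𝓑 : ‹MeasurableSpace Y› = generateFrom 𝓑) (h𝓑pi : IsPiSystem 𝓑)
    (A : ℕ → Set X) (hA : ∀ i, MeasurableSet (A i)) (hAcov : ⋃ i, A i = univ)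
    (B : ℕ → Set Y) (hB : ∀ j, B j ∈ 𝓑) (hBcov : ⋃ j, B j = univ)
    (hfin : ∀ i j, ν (A i ×ˢ B j) ≠ ∞)
    (h_eq : ∀ S : Set X, MeasurableSet S → ∀ T ∈ 𝓑, μ (S ×ˢ T) = κ * ν (S ×ˢ T)) : μ = κ • ν := by
  refine ext_of_measurable_prod_rectangles (ν := κ • ν) h𝓑 h𝓑pi A hA hAcov B hB hBcov (fun i j => ?_) (fun S hS T hT => ?_)
  · rw [h_eq (A i) (hA i) (B j) (hB j)]
    exact ENNReal.mul_ne_top ENNReal.coe_ne_top (hfin i j)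
  · rw [h_eq S hS T hT, Measure.smul_apply, ENNReal.smul_def, smul_eq_mul]

end Literature.MeasureTheory.Measure

end
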